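/-
Copyright (c) 2026 the pub-hodgecm-mathlib formalisation cell (harness21).  Prover seat hodgecm-mathlib-B-p10 (g25), link L1b of BOTH type-(2) closer chains
(:1189 `stub_irredGValuePos` κ = +1, B-p12 (g28); :1269 `stub_irredGValueNeg` κ = −1, B-p14 (g31)); LEAD F0P3a-plan (g9) T8-127, architect A-p06 (g26), 2026-09-01.
-/
import Literature.NumberTheory.Automorphic.UnitaryCyclicCentralizerCompactNonsplit    -- ★ B-p10 (g24) (E4′) p841587: `compactSpace_centralizer_of_not_exists_isRoot` (`Z_{U(Φ₂)}(γ₂)`)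
import Literature.NumberTheory.Automorphic.UnitOrbitalIntegralFixedPointsPair           -- ★ `compactSpace_centralizer_prod`, `compactSpace_cmDatum_local_one_of_smul_eq`
import Literature.NumberTheory.Rogawski1990.EndoscopicCentralizerIso                    -- ★ F0P3a-p04: `exists_localEndoCentralizerEquiv` (`Z_H(γ_H) ≃ₜ* Z_{G′}(δ)`)
import Literature.NumberTheory.Automorphic.LocalUnitaryIntegralLevel                    -- ★ `isUnit_placeForm_antidiagOne`
import HarnessLib

/-!
# The centraliser of a `G′`-element matching a TYPE-(2) `H`-class is COMPACT (both κ signs), via the endoscopic torus isomorphism `Z_H(γ_H) ≃ₜ* Z_{G′}(δ)`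
# (Rogawski 1990, §3.6 and §4.3: `G`-regular `γ_H` ⇒ `T_H = H_{γ_H} ≅ G′_δ`, an anisotropic torus at a non-split place)

Topic `NumberTheory/Automorphic`; namespace `Literature.NumberTheory.Automorphic.UnitaryGroup`.  THEOREMS ONLY (no `def`, no instance, no notation, no named fact, no
`sorry`); kernel lane; count-neutral.  Cell `pub/hodgecm-mathlib`, crux H413, line «N7nsCount» ED. 1.5: the `[CompactSpace Z_{G′_v}(δ)]` premise (link L1b) of the socket
★ `classOrbitalIntegral_indicator_complex_cmLocalIntegralLevel_eq_natCard_fixedBy` for the TWO type-(2) value stubs `stub_irredGValuePos` (:1189, κ = +1) and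
`stub_irredGValueNeg` (:1269, κ = −1), discharged ONCE and κ-FREE from binders the stubs carry BY NAME (`hH'u w hw hv h2 hreg hint hirr N hN` + the norm pair).
HONEST LABEL: HC_CM is proved only modulo the printed citations until rung 0 closes; topology for one premise of two value stubs of #103-ns.

THE MATHEMATICS [Rogawski1990, §4.3 pp. 42–44, §3.6 pp. 31–32].  For `γ_H = (γ₂, γ₁) ∈ H_v = U(Φ₂)(L⁺_v) × U(Φ₁)(L⁺_v)` `G`-regular and `δ ∈ G′_v = U(H′)(L⁺_v)` with `γ_H → δ`
(`IsLocalNormPair`), the endoscopic embedding gives `Z_{H_v}(γ_H) ≃ₜ* Z_{G′_v}(δ)` (★ `exists_localEndoCentralizerEquiv`).  When `χ_{γ₂,w}` has no root in `L_w` (type (2))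
`Z_{U(Φ₂)}(γ₂)` is compact (★ (E4′) `compactSpace_centralizer_of_not_exists_isRoot`), `U(Φ₁)(L⁺_v) = L_w¹` is compact (★ `compactSpace_cmDatum_local_one_of_smul_eq`), so
`Z_{H_v}(γ_H) = Z(γ₂) × Z(γ₁)` is compact (★ `compactSpace_centralizer_prod`), hence **`Z_{G′_v}(δ)` is compact** — no normal form, no parity of the corner norm.
(The κ = −1 normal-form route ★ `UnitaryThreeAnisotropicStabilizerCompact` remains available for statements inside `U(2,1)(L_w)`.)

* `compactSpace_centralizer_of_compactSpace` — a point centraliser in a compact Hausdorff topological group is compact.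
* **`compactSpace_centralizer_endoPair_of_not_exists_isRoot`** — `CompactSpace Z_{H_v}(γ_H)` for type-(2) `γ_H`.
* **`compactSpace_centralizer_of_isLocalNormPair_of_not_exists_isRoot`** — `CompactSpace Z_{G′_v}(δ)` for `γ_H → δ`, `γ_H` `G`-regular of type (2).

## References
* [Rogawski1990] J. D. Rogawski, *Automorphic Representations of Unitary Groups in Three Variables* (1990), §3.6 pp. 31–32, §4.3 pp. 42–44.
* [PlatonovRapinchuk1994] V. Platonov, A. Rapinchuk, *Algebraic Groups and Number Theory* (1994), §3.1 Thm. 3.1 (anisotropic tori over local fields are compact).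
* [Flicker1998UnitaryFL] Y. Z. Flicker, *Elementary proof of the fundamental lemma for a unitary group*, Canad. J. Math. 50 (1998), §6 p. 97 (the torus `(EL)¹ × E¹`).
-/

set_option autoImplicit false

noncomputable section

open NumberField IsDedekindDomain Matrix Topology ValuativeRel
open scoped ValuativeRel Matrix MatrixGroups

namespace Literature.NumberTheory.Automorphic.UnitaryGroup

open Literature.NumberTheory.Rogawski1990

/-! ## §1 A point centraliser in a compact group is compact -/

section Generic

/-- In a compact Hausdorff topological group every point centraliser is compact (it is closed: `{z | z * b = b * z}`).
[cite: PlatonovRapinchuk1994, §3.1 Thm. 3.1] -/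
theorem compactSpace_centralizer_of_compactSpace {B : Type*} [Group B] [TopologicalSpace B] [IsTopologicalGroup B] [T2Space B] [CompactSpace B] (b : B) :
    CompactSpace ↥(Subgroup.centralizer ({b} : Set B)) := by
  have hcl : IsClosed ((Subgroup.centralizer ({b} : Set B) : Subgroup B) : Set B) := by
    have : ((Subgroup.centralizer ({b} : Set B) : Subgroup B) : Set B) = {z : B | z * b = b * z} := by
      ext z; exact Subgroup.mem_centralizer_singleton_iff
    rw [this]
    exact isClosed_eq (continuous_id.mul continuous_const) (continuous_const.mul continuous_id)
  exact isCompact_iff_compactSpace.1 hcl.isCompact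

end Generic

/-! ## §2 `Z_{H_v}(γ_H)` and `Z_{G′_v}(δ)` are compact for type-(2) `γ_H` at a non-split place -/

section CM

variable (L : Type) [Field L] [NumberField L] [IsCMField L] (v : HeightOneSpectrum (𝓞 ↥(maximalRealSubfield L)))
  (w : PlacesOver L v) (hw : IsCMField.complexConj L • w.1 = w.1)

include hw in
/-- **`Z_{H_v}(γ_H)` IS COMPACT for a type-(2) `γ_H = (γ₂, γ₁)`** (`χ_{γ₂,w}` integral with no root in `L_w`, `2 ∈ 𝒪_w^×`, `|tr² − 4det|_w = |ϖ|^{2N+1}`, `v` non-split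
unramified): `Z(γ_H) = Z_{U(Φ₂)}(γ₂) × Z_{U(Φ₁)}(γ₁)` with ★ (E4′) for the first factor and `U(Φ₁)(L⁺_v) = L_w¹` compact for the second.
[cite: Rogawski1990, §3.6 pp. 31–32] [cite: Flicker1998UnitaryFL, §6 p. 97] -/
theorem compactSpace_centralizer_endoPair_of_not_exists_isRoot (hunr : Algebra.IsUnramifiedIn (𝓞 L) v.asIdeal)
    (γH : (cmDatum L 2 (Matrix.of fun i j : Fin 2 => if i.val + j.val + 1 = 2 then (1 : L) else 0)).Local v ×
      (cmDatum L 1 (Matrix.of fun i j : Fin 1 => if i.val + j.val + 1 = 1 then (1 : L) else 0)).Local v)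
    (h2 : IsUnit (2 : 𝒪[(w.1.adicCompletion L)]))
    (hint : ∀ i : ℕ, ((((endoEmbLocal L v γH).val : GL (Fin 3) (LocalRing L v)).val.map
      (Pi.evalRingHom (fun w' : PlacesOver L v => w'.1.adicCompletion L) w)).charpoly.coeff i) ∈ 𝒪[(w.1.adicCompletion L)])
    (hirr : ¬ ∃ x : (w.1.adicCompletion L), (((((γH.1.val : GL (Fin 2) (LocalRing L v)) : Matrix (Fin 2) (Fin 2) (LocalRing L v)).map
      (Pi.evalRingHom (fun w' : PlacesOver L v => w'.1.adicCompletion L) w))).charpoly).IsRoot x)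
    (N : ℕ) (hN : Valued.v (((((γH.1.val : GL (Fin 2) (LocalRing L v)) : Matrix (Fin 2) (Fin 2) (LocalRing L v)).map
        (Pi.evalRingHom (fun w' : PlacesOver L v => w'.1.adicCompletion L) w))).trace ^ 2 -
      4 * ((((γH.1.val : GL (Fin 2) (LocalRing L v)) : Matrix (Fin 2) (Fin 2) (LocalRing L v)).map
        (Pi.evalRingHom (fun w' : PlacesOver L v => w'.1.adicCompletion L) w))).det) = WithZero.exp (-((2 * N + 1 : ℕ) : ℤ))) :
    CompactSpace ↥(Subgroup.centralizer ({γH} : Set ((cmDatum L 2 (Matrix.of fun i j : Fin 2 => if i.val + j.val + 1 = 2 then (1 : L) else 0)).Local v ×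
      (cmDatum L 1 (Matrix.of fun i j : Fin 1 => if i.val + j.val + 1 = 1 then (1 : L) else 0)).Local v))) := by
  haveI := compactSpace_centralizer_of_not_exists_isRoot L v w hw hunr γH h2 hint hirr N hN
  haveI : CompactSpace ((cmDatum L 1 (Matrix.of fun i j : Fin 1 => if i.val + j.val + 1 = 1 then (1 : L) else 0)).Local v) :=
    compactSpace_cmDatum_local_one_of_smul_eq L (Matrix.of fun i j : Fin 1 => if i.val + j.val + 1 = 1 then (1 : L) else 0) w hw
      (isUnit_placeForm_antidiagOne (E := L) 1 w.1)
  haveI : CompactSpace ↥(Subgroup.centralizer ({γH.2} : Set ((cmDatum L 1 (Matrix.of fun i j : Fin 1 => if i.val + j.val + 1 = 1 then (1 : L) else 0)).Local v))) :=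
    compactSpace_centralizer_of_compactSpace γH.2
  have h := compactSpace_centralizer_prod γH.1 γH.2
  rwa [Prod.mk.eta] at h

include hw in
/-- **L1b, κ-FREE: `Z_{G′_v}(δ)` IS COMPACT for `δ ∈ U(H′)(L⁺_v)` matching a `G`-regular type-(2) `γ_H`** (`IsLocalNormPair L H' v γH δ`; binders of
`stub_irredGValuePos∕Neg` BY NAME).  The endoscopic torus isomorphism ★ `exists_localEndoCentralizerEquiv` carries the compact `Z_{H_v}(γ_H)` onto `Z_{G′_v}(δ)`.
[cite: Rogawski1990, §4.3 pp. 42–44, §3.6 pp. 31–32] [cite: PlatonovRapinchuk1994, §3.1 Thm. 3.1] -/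
theorem compactSpace_centralizer_of_isLocalNormPair_of_not_exists_isRoot {H' : Matrix (Fin 3) (Fin 3) L} (hH'u : IsUnit H')
    (hunr : Algebra.IsUnramifiedIn (𝓞 L) v.asIdeal)
    {γH : (cmDatum L 2 (Matrix.of fun i j : Fin 2 => if i.val + j.val + 1 = 2 then (1 : L) else 0)).Local v ×
      (cmDatum L 1 (Matrix.of fun i j : Fin 1 => if i.val + j.val + 1 = 1 then (1 : L) else 0)).Local v}
    (hreg : IsLocalGRegular L v γH) (h2 : IsUnit (2 : 𝒪[(w.1.adicCompletion L)]))
    (hint : ∀ i : ℕ, ((((endoEmbLocal L v γH).val : GL (Fin 3) (LocalRing L v)).val.map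
      (Pi.evalRingHom (fun w' : PlacesOver L v => w'.1.adicCompletion L) w)).charpoly.coeff i) ∈ 𝒪[(w.1.adicCompletion L)])
    (hirr : ¬ ∃ x : (w.1.adicCompletion L), (((((γH.1.val : GL (Fin 2) (LocalRing L v)) : Matrix (Fin 2) (Fin 2) (LocalRing L v)).map
      (Pi.evalRingHom (fun w' : PlacesOver L v => w'.1.adicCompletion L) w))).charpoly).IsRoot x)
    (N : ℕ) (hN : Valued.v (((((γH.1.val : GL (Fin 2) (LocalRing L v)) : Matrix (Fin 2) (Fin 2) (LocalRing L v)).map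
        (Pi.evalRingHom (fun w' : PlacesOver L v => w'.1.adicCompletion L) w))).trace ^ 2 -
      4 * ((((γH.1.val : GL (Fin 2) (LocalRing L v)) : Matrix (Fin 2) (Fin 2) (LocalRing L v)).map
        (Pi.evalRingHom (fun w' : PlacesOver L v => w'.1.adicCompletion L) w))).det) = WithZero.exp (-((2 * N + 1 : ℕ) : ℤ)))
    (δ : (cmDatum L 3 H').Local v) (hm : IsLocalNormPair L H' v γH δ) :
    CompactSpace ↥(Subgroup.centralizer ({δ} : Set ((cmDatum L 3 H').Local v))) := by
  haveI := compactSpace_centralizer_endoPair_of_not_exists_isRoot L v w hw hunr γH h2 hint hirr N hN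
  have hdet : H'.det ≠ 0 := ((Matrix.isUnit_iff_isUnit_det H').1 hH'u).ne_zero
  obtain ⟨e, -⟩ := exists_localEndoCentralizerEquiv L v hdet hreg hm
  exact e.toHomeomorph.compactSpace

end CM

end Literature.NumberTheory.Automorphic.UnitaryGroup

end
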